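import Literature.NumberTheory.EllipticCurves.CastellaGrossiLeeSkinner2022.HeegnerPointKolyvaginSystem
import Literature.NumberTheory.EllipticCurves.ZpExtensionEisensteinSelmerStructureProofs
import Literature.NumberTheory.GaloisCohomology.Howard2004.CoeffTowerKolyvaginSystemSmul
import HarnessLib

/-!
# The `Λ`-module structure on `𝐊𝐒(𝐓, 𝓕_Λ, 𝓛)` for the `Λ`-adic source setting `S_Λ` of an elliptic curve, and the
# normalised form `κ.one = Φ′(κ_∞)` of CGLS 2022 Thm. 4.1.1 + Rem. 4.1.4

Topic `NumberTheory/EllipticCurves` (cell `pub/bsd-print-x9`, literature seat g33, TRANCHE 6b; sequel of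
`ZpExtensionCoeffSelmerStructure` (A1: `𝓕_Λ` = `coeffSelmerStructure`), `ZpExtensionShapiroSetting` (A2: `S_Λ` =
`shapiroSettingTame`), `CastellaGrossiLeeSkinner2022.HeegnerPointKolyvaginSystem` (B: the fact `thm411_…` and its corollary
`exists_kolyvaginSystem_one_eq_of_thm411` CONDITIONAL on a `Λ`-action on Kolyvagin systems) and of lit's generic
`Howard2004.CoeffTowerKolyvaginSystemSmul` (6a: `r • κ` as the pushforward along `smulHom r`, given (a) `R_k`-linear levels,
(b) scalar-stable level conditions, (c) slots natural in the module).  Proved theorems and definitions with bodies; no named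
fact, no instance, no `sorry`; debt Δ 0.

CONTENTS.  §1 (generic over x9-p2's `coeffAdicTower`, twin of D1's `ZpExtensionEisensteinSelmerStructureProofs` §1–§2 for
the UNSATURATED `𝓕_Λ`): exact families / exact level conditions are stable under reduction-compatible core-preserving
endomorphisms (`Tower.map_mem_exactFamilies`, `map_mem_exactLevelCondition`); the local reductions commute with the
scalars `H¹(g•)`, `g ∈ Λ` (`coeffLocalRed_scalarMapH1`); the twisted plus part `Λ/I_k ⊗ Fil_v M_k` is a `Λ`-submodule and
the ordinary cores are `Λ`-stable (`smul_mem_coeffFil`, `scalarMapH1_mem_coeffOrdinaryCore`); hence **`𝓕_Λ` is a Selmer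
structure of `Λ`-MODULES** at every level (`isScalarStable_coeffSelmerStructure` — Howard Def. 1.1.1 «a local condition …
is a choice of `R`-submodule»).  §2 (the curve): (a)–(c) for `shapiroSettingTame` (`isScalarStable_shapiroTowerTriple`,
`fsNaturalAt_shapiroSettingTame` from lit g32's `tameSlotOn_natural_cohomologyMap`), whence **`shapiroKolyvaginSystemSmul
… r κ`** with `(…).one = 𝐓.smulFamily r κ.one` (`rfl`).  §3: the `smulKS` hypothesis of B's corollary DISCHARGED —
**`CastellaGrossiLeeSkinner2022.exists_kolyvaginSystem_one_eq`**: the fact `thm411_exists_kolyvaginSystem_one_ne_zero`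
ALONE yields a Kolyvagin system `κ ∈ 𝐊𝐒(𝐓, 𝓕_Λ, 𝓛_E)` with `κ.one = Φ′(z)` (`z = κ_∞`) and `κ.one ≠ 0`.
BSD is not proved by any of this.

References: B. Howard, *The Heegner point Kolyvagin system*, Compositio Math. **140** (2004), Def. 1.1.1, 1.1.8, 1.2.3,
Rem. 1.2.4, §2.2 Def. 2.2.5–2.2.6 (arXiv:1202.6340 pp. 5–7, p0016) [Howard2004HeegnerKolyvagin]; F. Castella, G. Grossi,
J. Lee, C. Skinner, Invent. Math. **227** (2022), §3.4, Thm. 4.1.1, Rem. 4.1.4 [CastellaGrossiLeeSkinner2022]; J.-P. Serre,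
*Galois Cohomology* (1997), I §2.4, §5.1 [SerreGaloisCohomology1997].
-/

set_option autoImplicit false

noncomputable section

open Function NumberField IsDedekindDomain Field IsLocalRing
open scoped NumberField ContRepresentation TensorProduct

namespace Literature.NumberTheory.EllipticCurves

open Literature.NumberTheory.GaloisRepresentations Literature.NumberTheory.GaloisRepresentations.DiscreteGaloisModule
open Literature.NumberTheory.GaloisCohomology.Howard2004

/-! ## §1a Exact level conditions are stable under compatible core-preserving endomorphisms -/

namespace Tower

variable {H : ℕ → Type} [∀ j, AddCommGroup (H j)] (red : ∀ j, H (j + 1) →+ H j)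

/-- **Exact families are stable under reduction-compatible core-preserving endomorphisms** `e_j : H_j → H_j`.
[cite: Howard2004HeegnerKolyvagin, Def. 1.1.1 (arXiv Def. 2.1.1: local conditions are R-submodules) and Def. 2.2.6] -/
theorem map_mem_exactFamilies (C : ∀ j, AddSubgroup (H j)) (e : ∀ j, H j →+ H j)
    (hred : ∀ j (x : H (j + 1)), red j (e (j + 1) x) = e j (red j x))
    (hC : ∀ j (x : H j), x ∈ C j → e j x ∈ C j) {x : Π j, H j} (hx : x ∈ exactFamilies red C) :
    (fun j ↦ e j (x j)) ∈ exactFamilies red C := by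
  rw [mem_exactFamilies_iff] at hx ⊢
  exact ⟨fun j ↦ by rw [hred, hx.1], fun j ↦ hC j _ (hx.2 j)⟩

/-- Hence the exact level-`k` condition is stable under `e_k`. [cite: Howard2004HeegnerKolyvagin, Def. 1.1.1 and Def. 1.1.3 (propagation)] -/
theorem map_mem_exactLevelCondition (C : ∀ j, AddSubgroup (H j)) (e : ∀ j, H j →+ H j)
    (hred : ∀ j (x : H (j + 1)), red j (e (j + 1) x) = e j (red j x))
    (hC : ∀ j (x : H j), x ∈ C j → e j x ∈ C j) {k : ℕ} {y : H k} (hy : y ∈ exactLevelCondition red C k) :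
    e k y ∈ exactLevelCondition red C k := by
  rw [mem_exactLevelCondition_iff] at hy ⊢
  obtain ⟨x, hx, rfl⟩ := hy
  exact ⟨fun j ↦ e j (x j), map_mem_exactFamilies red C e hred hC hx, rfl⟩

end Tower

/-! ## §1b `𝓕_Λ` is a Selmer structure of `Λ`-modules -/

namespace ZpExtension

variable {K : Type} [Field K] [NumberField K] {p : ℕ} [hp : Fact p.Prime] (κ : ZpExtension K p)
  {M : ℕ → Type} [∀ k, AddCommGroup (M k)] [∀ k, TopologicalSpace (M k)] [∀ k, DiscreteTopology (M k)]
  (ρ : ∀ k, DiscreteGaloisModule K (M k))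
  (t : ∀ k, (ρ (k + 1)).toContRepresentation →ⁱL (ρ k).toContRepresentation)
  (I : ℕ → Ideal (IwasawaAlgebra p)) (hI : ∀ k, I (k + 1) ≤ I k)
  (J : ℕ → ℕ) (hJ : ∀ k, ((1 + PowerSeries.X : IwasawaAlgebra p) ^ (p ^ J k) - 1) ∈ I k)
  (e : ℕ → ℕ) (he : ∀ k, maximalIdeal (IwasawaAlgebra p) ^ e k ≤ I k)
  (ht : ∀ k, Function.Surjective (t k))

/-- **The local reductions of the `Λ`-adic tower commute with the scalars**: `red_k (H¹(g•) x) = H¹(g•) (red_k x)` on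
`H¹(K_v, 𝐓_{k+1}) → H¹(K_v, 𝐓_k)`, `g ∈ Λ` (the reduction is `Λ`-linear).
[cite: Howard2004HeegnerKolyvagin, §2.2 Def. 2.2.3 (𝐓 a Λ[G_K]-module)] [cite: SerreGaloisCohomology1997, Ch. I §2.4] -/
theorem coeffLocalRed_scalarMapH1 (v : NumberField.Place K) (k : ℕ) (g : IwasawaAlgebra p)
    (x : galoisCohomology (((κ.coeffAdicTower ρ t I hI J hJ e he ht).ρ (k + 1)).toLocal v) 1) :
    κ.coeffLocalRed ρ t I hI J hJ e he ht v k
        (galoisCohomology.scalarMapH1 (((κ.coeffAdicTower ρ t I hI J hJ e he ht).ρ (k + 1)).toLocal v)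
          (((κ.coeffAdicTower ρ t I hI J hJ e he ht).hlin (k + 1)).restrictField (NumberField.Place.Completion v)) g x) =
      galoisCohomology.scalarMapH1 (((κ.coeffAdicTower ρ t I hI J hJ e he ht).ρ k).toLocal v)
        (((κ.coeffAdicTower ρ t I hI J hJ e he ht).hlin k).restrictField (NumberField.Place.Completion v)) g
        (κ.coeffLocalRed ρ t I hI J hJ e he ht v k x) :=
  DiscreteGaloisModule.map_scalarMapH1_of_semilinear
    (ρ := ((κ.coeffAdicTower ρ t I hI J hJ e he ht).ρ (k + 1)).toLocal v)
    (ρ' := ((κ.coeffAdicTower ρ t I hI J hJ e he ht).ρ k).toLocal v) _ _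
    (DiscreteGaloisModule.localMap (κ.coeffLevelReduce ρ t I hI J hJ k) v)
    (fun m ↦ ((κ.coeffAdicTower ρ t I hI J hJ e he ht).red k).map_smul g m) x

/-- The same at a finite place in the spelling `GaloisRep.toLocal v` (definitionally the same statement).
[cite: Howard2004HeegnerKolyvagin, §2.2] [cite: SerreGaloisCohomology1997, Ch. I §2.4] -/
theorem coeffLocalRed_scalarMapH1_inr (v : HeightOneSpectrum (𝓞 K)) (k : ℕ) (g : IwasawaAlgebra p)
    (x : galoisCohomology (GaloisRep.toLocal v ((κ.coeffAdicTower ρ t I hI J hJ e he ht).ρ (k + 1))) 1) :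
    κ.coeffLocalRed ρ t I hI J hJ e he ht (Sum.inr v) k
        (galoisCohomology.scalarMapH1 (GaloisRep.toLocal v ((κ.coeffAdicTower ρ t I hI J hJ e he ht).ρ (k + 1)))
          (((κ.coeffAdicTower ρ t I hI J hJ e he ht).hlin (k + 1)).restrictField (v.adicCompletion K)) g x) =
      galoisCohomology.scalarMapH1 (GaloisRep.toLocal v ((κ.coeffAdicTower ρ t I hI J hJ e he ht).ρ k))
        (((κ.coeffAdicTower ρ t I hI J hJ e he ht).hlin k).restrictField (v.adicCompletion K)) g
        (κ.coeffLocalRed ρ t I hI J hJ e he ht (Sum.inr v) k x) :=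
  κ.coeffLocalRed_scalarMapH1 ρ t I hI J hJ e he ht (Sum.inr v) k g x

section Cores

variable {κ ρ t} {v : HeightOneSpectrum (𝓞 K)} (Φ : OrdinaryFiltration ρ t v)

/-- **The twisted plus part `Λ/I_k ⊗ Fil_v M_k` is a `Λ`-submodule of `𝐓_k`** (`g • (c ⊗ a) = ([g] c) ⊗ a`).
[cite: Howard2004HeegnerKolyvagin, Def. 2.2.5 (Fil_v 𝐓 = Fil_v T ⊗ Λ, a Λ-submodule)] -/
theorem smul_mem_coeffFil (k : ℕ) (g : IwasawaAlgebra p) {x : CoeffLevel p I M k} (hx : x ∈ coeffFil I Φ k) :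
    g • x ∈ coeffFil I Φ k := by
  induction hx using Submodule.span_induction with
  | mem y hy =>
    obtain ⟨c, a, ha, rfl⟩ := hy
    rw [CoeffLevel.iwasawa_smul_def]
    -- `[g] • (c ⊗ a) = ([g] c) ⊗ a` definitionally (`TensorProduct.smul_tmul'`)
    exact tmul_mem_coeffFil I Φ k (Ideal.Quotient.mk (I k) g * c) ha
  | zero => rw [smul_zero]; exact zero_mem _
  | add y z _ _ hy hz => rw [smul_add]; exact add_mem hy hz
  | smul n y _ hy => rw [smul_comm]; exact Submodule.smul_mem _ n hy

/-- **The ordinary cores are `Λ`-submodules**: the strict condition `ker (H¹(K_v, 𝐓_k) → H¹(K_v, 𝐓_k/𝐓_k⁺))` is stable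
under `H¹(g•)`, `g ∈ Λ`. [cite: Howard2004HeegnerKolyvagin, Def. 1.1.1 and Def. 2.2.6] -/
theorem scalarMapH1_mem_coeffOrdinaryCore (k : ℕ) (g : IwasawaAlgebra p)
    {x : galoisCohomology (GaloisRep.toLocal v ((κ.coeffAdicTower ρ t I hI J hJ e he ht).ρ k)) 1}
    (hx : x ∈ coeffOrdinaryCore I hI J hJ e he ht Φ k) :
    galoisCohomology.scalarMapH1 (GaloisRep.toLocal v ((κ.coeffAdicTower ρ t I hI J hJ e he ht).ρ k))
        (((κ.coeffAdicTower ρ t I hI J hJ e he ht).hlin k).restrictField (v.adicCompletion K)) g x ∈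
      coeffOrdinaryCore I hI J hJ e he ht Φ k :=
  DiscreteGaloisModule.scalarMapH1_mem_strictSubgroup _ _ _ g (fun _ hw ↦ smul_mem_coeffFil I Φ k g hw) hx

end Cores

variable (S : Finset (HeightOneSpectrum (𝓞 K)))
  (Φ : ∀ v : HeightOneSpectrum (𝓞 K), ((p : ℕ) : 𝓞 K) ∈ v.asIdeal → OrdinaryFiltration ρ t v)

/-- **`𝓕_Λ` is a Selmer structure of `Λ`-modules** (Howard Def. 1.1.1: «a local condition … is a choice of
`R`-submodule of `H¹(K_v, T)`»): at every place the level-`k` condition `coeffSelmerStructure` is stable under the local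
scalar action `H¹(g•)`, `g ∈ Λ` (tree `SelmerStructure.IsScalarStable`).  Proof: `⊤` at `∞`; at `v ∣ p` and at `v ∈ S`
the exact level conditions are stable under the reduction-compatible system `(H¹(g•))_j`, which preserves the ordinary
cores (resp. `⊤`); the unramified condition is stable.
[cite: Howard2004HeegnerKolyvagin, Def. 1.1.1 (arXiv Def. 2.1.1) and Def. 2.2.6] [cite: CastellaGrossiLeeSkinner2022, §3.4 (𝓕_Λ)] -/
theorem isScalarStable_coeffSelmerStructure (k : ℕ) :
    (κ.coeffSelmerStructure ρ t I hI J hJ e he ht S Φ k).IsScalarStable ((κ.coeffAdicTower ρ t I hI J hJ e he ht).hlin k) := by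
  classical
  rw [DiscreteGaloisModule.SelmerStructure.isScalarStable_iff]
  intro v g x hx
  rcases v with w | v
  · rw [coeffSelmerStructure_inl] at hx ⊢
    exact AddSubgroup.mem_top _
  · by_cases hv : ((p : ℕ) : 𝓞 K) ∈ v.asIdeal
    · rw [κ.coeffSelmerStructure_inr_of_mem ρ t I hI J hJ e he ht S Φ k hv] at hx ⊢
      exact Tower.map_mem_exactLevelCondition _ _
        (fun j ↦ galoisCohomology.scalarMapH1 (GaloisRep.toLocal v ((κ.coeffAdicTower ρ t I hI J hJ e he ht).ρ j))
          (((κ.coeffAdicTower ρ t I hI J hJ e he ht).hlin j).restrictField (v.adicCompletion K)) g)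
        (fun j y ↦ κ.coeffLocalRed_scalarMapH1_inr ρ t I hI J hJ e he ht v j g y)
        (fun j y hy ↦ scalarMapH1_mem_coeffOrdinaryCore I hI J hJ e he ht (Φ v hv) j g hy) hx
    · by_cases hvS : v ∈ S
      · rw [κ.coeffSelmerStructure_inr_of_mem_of_not_mem ρ t I hI J hJ e he ht S Φ k hv hvS] at hx ⊢
        exact Tower.map_mem_exactLevelCondition _ _
          (fun j ↦ galoisCohomology.scalarMapH1 (GaloisRep.toLocal v ((κ.coeffAdicTower ρ t I hI J hJ e he ht).ρ j))
            (((κ.coeffAdicTower ρ t I hI J hJ e he ht).hlin j).restrictField (v.adicCompletion K)) g)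
          (fun j y ↦ κ.coeffLocalRed_scalarMapH1_inr ρ t I hI J hJ e he ht v j g y)
          (fun j y _ ↦ AddSubgroup.mem_top _) hx
      · rw [κ.coeffSelmerStructure_inr_of_not_mem ρ t I hI J hJ e he ht S Φ k hv hvS] at hx ⊢
        exact DiscreteGaloisModule.scalarMapH1_mem_unramifiedSubgroup
          (((κ.coeffAdicTower ρ t I hI J hJ e he ht).hlin k).restrictField (v.adicCompletion K)) _ hx

/-- **`H¹_{𝓕_Λ}(K, 𝐓_k)` is a `Λ`-submodule**: `H¹(g•)` preserves the level Selmer group.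
[cite: Howard2004HeegnerKolyvagin, Def. 1.1.10 (arXiv Def. 2.1.10: the Selmer module)] -/
theorem scalarMapH1_mem_selmerGroup_coeffSelmerStructure (k : ℕ) (g : IwasawaAlgebra p)
    {x : galoisCohomology ((κ.coeffAdicTower ρ t I hI J hJ e he ht).ρ k) 1}
    (hx : x ∈ (κ.coeffSelmerStructure ρ t I hI J hJ e he ht S Φ k).selmerGroup) :
    galoisCohomology.scalarMapH1 ((κ.coeffAdicTower ρ t I hI J hJ e he ht).ρ k)
        ((κ.coeffAdicTower ρ t I hI J hJ e he ht).hlin k) g x ∈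
      (κ.coeffSelmerStructure ρ t I hI J hJ e he ht S Φ k).selmerGroup :=
  DiscreteGaloisModule.SelmerStructure.scalarMapH1_mem_selmerGroup _
    (κ.isScalarStable_coeffSelmerStructure ρ t I hI J hJ e he ht S Φ k) g hx

end ZpExtension

end Literature.NumberTheory.EllipticCurves

/-! ## §2 The curve: `𝐊𝐒(𝐓, 𝓕_Λ, 𝓛)` over `S_Λ` is a `Λ`-module -/

namespace WeierstrassCurve

open Literature.NumberTheory.EllipticCurves Literature.NumberTheory.EllipticCurves.ZpExtension
open Literature.NumberTheory.GaloisRepresentations Literature.NumberTheory.GaloisRepresentations.DiscreteGaloisModule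
open Literature.NumberTheory.GaloisCohomology.Howard2004

variable {K : Type} [Field K] [NumberField K] (W : WeierstrassCurve ℚ) [W.IsElliptic] {p : ℕ} [hp : Fact p.Prime]
  (κ : ZpExtension K p)

section Triple

variable (S : Finset (HeightOneSpectrum (𝓞 K)))
  (hpS : ∀ v : HeightOneSpectrum (𝓞 K), ((p : ℕ) : 𝓞 K) ∈ v.asIdeal → v ∈ S)
  (hbad : ∀ v : HeightOneSpectrum (𝓞 K), v ∉ S → ((p : ℕ) : 𝓞 K) ∉ v.asIdeal → (W.baseChange K).HasGoodReductionAt v)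
  (L : Set (HeightOneSpectrum (𝓞 K))) (hL : L ⊆ (W.shapiroTower K p κ).degreeTwoPrimes p) (hLS : ∀ v ∈ L, v ∉ S)

/-- **(b) for `S_Λ`**: the level conditions `𝓕_Λ` of the Shapiro tower of `E_K` are `Λ`-stable, place by place.
[cite: Howard2004HeegnerKolyvagin, Def. 1.1.1 and Def. 2.2.6] [cite: CastellaGrossiLeeSkinner2022, §3.4 (𝓕_Λ)] -/
theorem isScalarStable_shapiroTowerTriple (j : ℕ) :
    (W.shapiroTowerTriple κ S hpS hbad L hL hLS j).cond.IsScalarStable ((W.shapiroTower K p κ).hlin j) :=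
  κ.isScalarStable_coeffSelmerStructure (fun j ↦ (W.baseChange K).torsionGaloisModule ((p : ℤ) ^ (j + 1)))
    (fun j ↦ (W.baseChange K).torsionGaloisModuleReduce p (j + 1)) (fun j ↦ shapiroIdeal p (j + 1))
    (fun j ↦ shapiroIdeal_succ_le p (j + 1)) (fun j ↦ j + 1) (fun j ↦ omega_mem_shapiroIdeal p (j + 1))
    (fun j ↦ (j + 1) * p ^ (j + 1) + (j + 1)) (fun j ↦ maximalIdeal_pow_le_shapiroIdeal p (j + 1))
    (fun j ↦ (W.baseChange K).torsionGaloisModuleReduce_surjective p (j + 1)) S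
    (fun v _ ↦ ((W.baseChange K).ordinaryFiltrationAt v (fun k ↦ (W.baseChange K).torsionGaloisModuleReduce p k)
      (fun _ _ ↦ rfl)).succ) j

end Triple

section Tame

variable (π : ∀ v : HeightOneSpectrum (𝓞 K), TamePin v)
  (P : Finset (HeightOneSpectrum (𝓞 K)) → HeightOneSpectrum (𝓞 K) → Prop)
  (hP : ∀ j n v, P n v → TameHyp (fun n ↦ W.shapiroLevelQuot κ j n) n v)
  (S : Finset (HeightOneSpectrum (𝓞 K)))
  (hpS : ∀ v : HeightOneSpectrum (𝓞 K), ((p : ℕ) : 𝓞 K) ∈ v.asIdeal → v ∈ S)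
  (hbad : ∀ v : HeightOneSpectrum (𝓞 K), v ∉ S → ((p : ℕ) : 𝓞 K) ∉ v.asIdeal → (W.baseChange K).HasGoodReductionAt v)
  (L : Set (HeightOneSpectrum (𝓞 K))) (hL : L ⊆ (W.shapiroTower K p κ).degreeTwoPrimes p) (hLS : ∀ v ∈ L, v ∉ S)
  (jbar : AlgebraicClosure K →+* ℂ) (cd : ConjugationDatum K)
  (πbar : letI := W.shapiroResidueModule K p
    ∀ j, W.ShapiroLevel K p j →ₗ[IwasawaAlgebra p ⧸ shapiroIdeal p (j + 1)] (W.baseChange K).geomTorsion (p : ℤ))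
  (D : ∀ j, DualityDatum p cd ((W.shapiroTower K p κ).ρ j) (IwasawaAlgebra p ⧸ shapiroIdeal p (j + 1)))

set_option synthInstance.maxHeartbeats 80000 in
/-- **(c) for `S_Λ`: the tame slots are natural in the module along every equivariant `Λ/I`-linear endomorphism of a
Kolyvagin quotient**, at every `(n, λ)` (same guard on both sides; lit g32's `tameSlotOn_natural_cohomologyMap` with
`Ψ = H¹_s(g)`). [cite: Howard2004HeegnerKolyvagin, Prop. 1.1.7 / Def. 1.1.8 (arXiv p. 5, L115–131)] -/
theorem fsNaturalAt_shapiroSettingTame (j : ℕ) (n : Finset (HeightOneSpectrum (𝓞 K))) (v : HeightOneSpectrum (𝓞 K)) :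
    letI := W.shapiroResidueModule K p
    ((W.shapiroSettingTame κ π P hP S hpS hbad L hL hLS jbar cd πbar D).LD j).FsNaturalAt n n v := by
  letI := W.shapiroResidueModule K p
  haveI := fun n ↦ W.finite_shapiroLevelQuotCarrier (K := K) (p := p) κ j n
  intro g hg c _
  exact tameSlotOn_natural_cohomologyMap π (fun n ↦ W.shapiroLevelQuot κ j n) (fun n ↦ W.shapiroLevelQuot κ j n) P
    (hP j) (hP j) n v g.toAddMonoidHom hg _ (fun x ↦ rfl) c

set_option synthInstance.maxHeartbeats 80000 in
/-- **The scalar `r • κ` on `𝐊𝐒(𝐓, 𝓕_Λ, 𝓛)` over `S_Λ`** (Howard Def. 1.2.3: the `Λ`-module of Kolyvagin systems): lit's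
generic `KolyvaginSystem.smul` with (a) `isScalarLinear_shapiroTower_coeff`, (b) `isScalarStable_shapiroTowerTriple`, (c)
`fsNaturalAt_shapiroSettingTame`. [cite: Howard2004HeegnerKolyvagin, Def. 1.2.3 «the R-module of Kolyvagin systems» (arXiv p. 7, L7–9) and Rem. 1.2.4] -/
def shapiroKolyvaginSystemSmul (r : IwasawaAlgebra p)
    (ks : letI := W.shapiroResidueModule K p
      (W.shapiroSettingTame κ π P hP S hpS hbad L hL hLS jbar cd πbar D).KolyvaginSystem) :
    letI := W.shapiroResidueModule K p
    (W.shapiroSettingTame κ π P hP S hpS hbad L hL hLS jbar cd πbar D).KolyvaginSystem :=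
  letI := W.shapiroResidueModule K p
  CoeffTowerSetting.KolyvaginSystem.smul (W.shapiroSettingTame κ π P hP S hpS hbad L hL hLS jbar cd πbar D)
    (W.isScalarLinear_shapiroTower_coeff κ) (W.isScalarStable_shapiroTowerTriple κ S hpS hbad L hL hLS)
    (W.fsNaturalAt_shapiroSettingTame κ π P hP S hpS hbad L hL hLS jbar cd πbar D) (fun _ ↦ rfl) r ks

set_option synthInstance.maxHeartbeats 80000 in
/-- **`(r • κ).one = r • κ.one`** for `S_Λ` (`• = AdicTower.smulFamily` on `lim_j H¹(K, 𝐓_j)`), definitionally.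
[cite: Howard2004HeegnerKolyvagin, Def. 1.2.3 and §2.2 (𝔖 as a Λ-module)] -/
@[simp] theorem shapiroKolyvaginSystemSmul_one (r : IwasawaAlgebra p)
    (ks : letI := W.shapiroResidueModule K p
      (W.shapiroSettingTame κ π P hP S hpS hbad L hL hLS jbar cd πbar D).KolyvaginSystem) :
    letI := W.shapiroResidueModule K p
    (W.shapiroKolyvaginSystemSmul κ π P hP S hpS hbad L hL hLS jbar cd πbar D r ks).one =
      (W.shapiroTower K p κ).smulFamily r ks.one :=
  rfl

end Tame

end WeierstrassCurve

/-! ## §3 CGLS 2022 Thm. 4.1.1 + Rem. 4.1.4, normalised: `κ.one = Φ′(κ_∞)` from the fact alone -/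

namespace Literature.NumberTheory.EllipticCurves.CastellaGrossiLeeSkinner2022

open WeierstrassCurve Literature.NumberTheory.EllipticCurves Literature.NumberTheory.EllipticCurves.ZpExtension
open Literature.NumberTheory.GaloisRepresentations Literature.NumberTheory.GaloisCohomology.Howard2004

variable {N : ℕ} [NeZero N] {W : WeierstrassCurve ℚ} [W.IsElliptic] [W.IsGloballyMinimal] {K : Type} [Field K]
  [NumberField K] {p : ℕ} [hp : Fact p.Prime] {κ : ZpExtension K p} {γ : Field.absoluteGaloisGroup K}
  {jbar : AlgebraicClosure K →+* ℂ}

set_option synthInstance.maxHeartbeats 80000 in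
/-- **The scalar `r • κ` on the Kolyvagin systems of `thm411Setting`** (`= shapiroKolyvaginSystemSmul` at `Ψ⁻¹`,
`S = {v ∣ pN}`, `𝓛 = 𝓛_E`). [cite: Howard2004HeegnerKolyvagin, Def. 1.2.3 «the R-module of Kolyvagin systems»] [cite: CastellaGrossiLeeSkinner2022, Rem. 4.1.4 (Λ-submodule generated by κ₁^{Hg})] -/
def thm411KolyvaginSystemSmul (hyp : Thm413Hypotheses N W K p κ γ) (jbar : AlgebraicClosure K →+* ℂ)
    (π : ∀ v : HeightOneSpectrum (𝓞 K), TamePin v)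
    (P : Finset (HeightOneSpectrum (𝓞 K)) → HeightOneSpectrum (𝓞 K) → Prop)
    (hP : ∀ j n v, P n v → TameHyp (fun n ↦ W.shapiroLevelQuot (κ.unitTwist (-1)) j n) n v)
    (cd : ConjugationDatum K)
    (πbar : letI := W.shapiroResidueModule K p
      ∀ j, W.ShapiroLevel K p j →ₗ[IwasawaAlgebra p ⧸ shapiroIdeal p (j + 1)] (W.baseChange K).geomTorsion (p : ℤ))
    (Dsrc : ∀ j, DualityDatum p cd ((W.shapiroTower K p (κ.unitTwist (-1))).ρ j) (IwasawaAlgebra p ⧸ shapiroIdeal p (j + 1)))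
    (r : IwasawaAlgebra p)
    (ks : letI := W.shapiroResidueModule K p
      (thm411Setting N W K p κ γ hyp jbar π P hP cd πbar Dsrc).KolyvaginSystem) :
    letI := W.shapiroResidueModule K p
    (thm411Setting N W K p κ γ hyp jbar π P hP cd πbar Dsrc).KolyvaginSystem :=
  W.shapiroKolyvaginSystemSmul (κ.unitTwist (-1)) π P hP _ _ _ _ _ _ jbar cd πbar Dsrc r ks

set_option synthInstance.maxHeartbeats 80000 in
/-- `(r • κ).one = r • κ.one` for `thm411Setting`. [cite: Howard2004HeegnerKolyvagin, Def. 1.2.3] -/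
@[simp] theorem thm411KolyvaginSystemSmul_one (hyp : Thm413Hypotheses N W K p κ γ) (jbar : AlgebraicClosure K →+* ℂ)
    (π : ∀ v : HeightOneSpectrum (𝓞 K), TamePin v)
    (P : Finset (HeightOneSpectrum (𝓞 K)) → HeightOneSpectrum (𝓞 K) → Prop)
    (hP : ∀ j n v, P n v → TameHyp (fun n ↦ W.shapiroLevelQuot (κ.unitTwist (-1)) j n) n v)
    (cd : ConjugationDatum K)
    (πbar : letI := W.shapiroResidueModule K p
      ∀ j, W.ShapiroLevel K p j →ₗ[IwasawaAlgebra p ⧸ shapiroIdeal p (j + 1)] (W.baseChange K).geomTorsion (p : ℤ))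
    (Dsrc : ∀ j, DualityDatum p cd ((W.shapiroTower K p (κ.unitTwist (-1))).ρ j) (IwasawaAlgebra p ⧸ shapiroIdeal p (j + 1)))
    (r : IwasawaAlgebra p)
    (ks : letI := W.shapiroResidueModule K p
      (thm411Setting N W K p κ γ hyp jbar π P hP cd πbar Dsrc).KolyvaginSystem) :
    letI := W.shapiroResidueModule K p
    (thm411KolyvaginSystemSmul hyp jbar π P hP cd πbar Dsrc r ks).one =
      (W.shapiroTower K p (κ.unitTwist (-1))).smulFamily r ks.one :=
  rfl

set_option synthInstance.maxHeartbeats 80000 in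
/-- **CGLS 2022 Thm. 4.1.1 with Rem. 4.1.4 (last sentence), NORMALISED — from the fact alone**: under the §3.2/§4.1 standing
hypotheses, for `z = κ_∞ ∈ 𝔖` (projections = the stabilised classes) and every choice of the presentation slots, there is a
Kolyvagin system `κ ∈ 𝐊𝐒(𝐓, 𝓕_Λ, 𝓛_E)` with **`κ.one = Φ′(z)`** and **`κ.one ≠ 0`** — B's `exists_kolyvaginSystem_one_eq_of_thm411`
with its `Λ`-action hypothesis discharged by `thm411KolyvaginSystemSmul` (the printed `κ^{Hg}` rescaled by the `b ∈ Λ` of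
«`κ_∞ ∈ Λ κ₁^{Hg}`»). [cite: CastellaGrossiLeeSkinner2022, Thm. 4.1.1 and Rem. 4.1.4, last sentence (arXiv v2 TeX L2203–2206, L2291–2294)] [cite: Howard2004HeegnerKolyvagin, Def. 1.2.3 (KS is an R-module)] -/
theorem exists_kolyvaginSystem_one_eq (h : thm411_exists_kolyvaginSystem_one_ne_zero)
    (hyp : Thm413Hypotheses N W K p κ γ) (D : (W.baseChange K).LambdaAdicSelmerData κ γ)
    (C : StabilizedHeegnerData N W K κ jbar) (z : D.S)
    (hz : ∀ (k : ℕ) (hk : C.depth < k), D.proj k z ∈ stabilizedClassLayer C k hk)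
    (π : ∀ v : HeightOneSpectrum (𝓞 K), TamePin v)
    (P : Finset (HeightOneSpectrum (𝓞 K)) → HeightOneSpectrum (𝓞 K) → Prop)
    (hP : ∀ j n v, P n v → TameHyp (fun n ↦ W.shapiroLevelQuot (κ.unitTwist (-1)) j n) n v)
    (hPlev : ∀ n ∈ levels (heegnerKolyvaginPrimes W (κ.unitTwist (-1)) (placesDividing K (p * N) mul_level_ne_zero)),
      ∀ v ∈ n, P n v)
    (cd : ConjugationDatum K)
    (πbar : letI := W.shapiroResidueModule K p
      ∀ j, W.ShapiroLevel K p j →ₗ[IwasawaAlgebra p ⧸ shapiroIdeal p (j + 1)] (W.baseChange K).geomTorsion (p : ℤ))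
    (Dsrc : ∀ j, DualityDatum p cd ((W.shapiroTower K p (κ.unitTwist (-1))).ρ j) (IwasawaAlgebra p ⧸ shapiroIdeal p (j + 1))) :
    letI := W.shapiroResidueModule K p
    ∃ κKS : (thm411Setting N W K p κ γ hyp jbar π P hP cd πbar Dsrc).KolyvaginSystem,
      κKS.one = (W.toShapiroSuccLimitH1 D hyp.topGenerator hyp.noPTorsion z).1 ∧ κKS.one ≠ 0 :=
  exists_kolyvaginSystem_one_eq_of_thm411 h hyp D C z hz π P hP hPlev cd πbar Dsrc
    (thm411KolyvaginSystemSmul hyp jbar π P hP cd πbar Dsrc) (fun _ _ ↦ rfl)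

end Literature.NumberTheory.EllipticCurves.CastellaGrossiLeeSkinner2022

end
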